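import Summits.Ventures.YMGap.Thresholds.DSWindowCertificateLGT
import HarnessLib

/-!
# Venture YMGap — track (c) «DS»: the VERTEX-STAR window system on the torus and its door
# (kernel side of the cell's STAR DOOR, PLAN R87/R91)

HONEST FRAMING: venture file (cell `pub-ymgap`), strong-coupling LATTICE bookkeeping only (currency:
exponential clustering of local observables of a plaquette-weight / `SU(N)` Wilson lattice gauge
measure on a finite torus, constants uniform in the volume). This file makes the WINDOW-SYSTEM half
of the cell's star door a kernel theorem, on EVERY torus `(ℤ/L)^d` (no parity assumption): the
window of a link `c` is the VERTEX STAR of its base point — the `2d` links having `c.1` as an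
endpoint — so a link `x` lies in the windows of the `2d` links based at its two endpoints
(`N⋆ = 2d`), and the averaged received-sum condition (H2) of the tree door
`DobrushinShlosman.abs_covariance_le` follows from a UNIFORM per-star, per-link bound: given ANY
nonnegative influence array `K(s; y → x)` (star vertex `s`, boundary link `y`, star link `x`) that
(i) is supported on boundary links `y` both of whose endpoints are at periodic sup-distance `≤ 1`
from `s` (automatic for links on a vertex plaquette at `s`: `torusNorm_linkEnds_sub_le_one`),
(ii) satisfies the window contraction (H1) `IsLinkWindowContraction` for the star windows over the
WHOLE exterior field space, and (iii) has `Σ_y K(s; y → x) ≤ ρ` for every star `s ∋ x`, with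
`ρ < 1`, one gets `|cov(f, g)| ≤ 4 R² e^{−κ₁ L₀} (Σ δf)(Σ δg)`, `κ₁ = (1 − ρ)²/(2(4dρ + 1))`
(`d = 4`: `(1 − ρ)²/(2(16ρ + 1))`), where `L₀` is the periodic sup-distance between the endpoints of
the supports — `star_abs_covariance_le`; for `SU(2)`, `d = 4` the named hypothesis schema
`StarWindowBound` and the door `su2Star_abs_covariance_le`.

NOT HERE (and NOT claimed): the array itself. For `SU(2)`, `d = 4` the cell's STAR-DOOR.md /
STAR-PROOF.md (seat ds-4, Lemma S) proposes one with received sum `starR β_W τ₅ κ_q Λ₃` (tree: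
`Summit.Ventures.YMGap.StarWindow.starR`, `starR_quarter_lt_one`, `starR_11_40_lt_one` under
certified enclosures) — a pen-and-paper lemma (class A, referee F-71) with certified tables (class
C); it enters below ONLY through `StarWindowBound` / `hcontract`, `hKloc`, `hsum`. No continuum,
confinement or mass-gap claim.

Contents: `linkEnds`, `vertexStar`, `starWin` (`= vertexStar c.1`), `self_mem_starWin`,
`card_filter_mem_starWin_le` (`N⋆ ≤ 2d`), `isDSReceivedSum_starWin` ((H2) from the per-star bound);
corner geometry `linkEnds_sub_eq_zero_or_one`, `torusNorm_linkEnds_sub_le_one` (endpoints of two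
links on a common plaquette are at periodic sup-distance `≤ 1` — the support condition);
`exists_starProfile`, `starCertificate`, `star_abs_covariance_le` (any compact group, any positive
continuous plaquette weight, any torus side); `StarWindowBound L βW ρ r` — the NAMED HYPOTHESIS
SCHEMA Lemma S must deliver on `(ℤ/L)^4` — and the door `su2Star_abs_covariance_le`.

References: Dobrushin–Shlosman (1985), condition `C_V`; Föllmer, LNM 1362 (1988) Ch. I (2.13),
(2.23); cell `pub-ymgap` PLAN R87/R91, ds/ds4/STAR-DOOR.md (the array, not used here).
-/

noncomputable section

open MeasureTheory ProbabilityTheory Function Finset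
open Literature.Probability.LatticeModels
open Literature.MathematicalPhysics.QuantumLattice (groupHeatKernelMeasure fundamentalRep)
open Literature.MathematicalPhysics.QuantumFieldTheory
open Literature.MathematicalPhysics.QuantumFieldTheory.Balaban1983to89.StrongCouplingTorusWindow
  (wilsonPlaqWeight wilsonMeasure_eq_groupHeatKernelMeasure continuous_wilsonPlaqWeight
  wilsonPlaqWeight_pos)

namespace Summit.Ventures.YMGap.DSWindow

variable {d L : ℕ}

/-! ### Endpoints, vertex stars, star windows -/

section Stars

/-- The two **endpoints** of the link `x = (s, μ)`: `s` and `s + e_μ`. -/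
def linkEnds (x : Edge d L) : Finset (Site d L) :=
  {x.1, x.1.shift x.2}

/-- Membership in `linkEnds`. -/
theorem mem_linkEnds {x : Edge d L} {v : Site d L} : v ∈ linkEnds x ↔ v = x.1 ∨ v = x.1.shift x.2 := by
  simp [linkEnds]

/-- The base point is an endpoint. -/
theorem fst_mem_linkEnds (x : Edge d L) : x.1 ∈ linkEnds x := mem_linkEnds.2 (Or.inl rfl)

/-- The tip is an endpoint. -/
theorem shift_mem_linkEnds (x : Edge d L) : x.1.shift x.2 ∈ linkEnds x := mem_linkEnds.2 (Or.inr rfl)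

/-- A link has an endpoint. -/
theorem linkEnds_nonempty (x : Edge d L) : (linkEnds x).Nonempty := ⟨x.1, fst_mem_linkEnds x⟩
variable [NeZero L]

/-- The **vertex star** of the site `s`: the links having `s` as an endpoint (`2d` of them on a
torus of side `≥ 3`: `d` outgoing, `d` incoming). -/
def vertexStar (s : Site d L) : Finset (Edge d L) :=
  univ.filter fun x => s ∈ linkEnds x

/-- Membership in a vertex star. -/
theorem mem_vertexStar {s : Site d L} {x : Edge d L} : x ∈ vertexStar s ↔ s ∈ linkEnds x := by simp [vertexStar]

/-- The **star window** of the link `c`: the vertex star of its base point. The window kernel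
`γ_{starWin c}(· | ω)` of the torus weight specification is the law of the `2d` star links given the
exterior — the star kernel of the cell's STAR-DOOR.md at the vertex `c.1`. -/
def starWin (c : Edge d L) : Finset (Edge d L) :=
  vertexStar c.1

/-- Membership in a star window. -/
theorem mem_starWin {c x : Edge d L} : x ∈ starWin c ↔ c.1 ∈ linkEnds x := mem_vertexStar

/-- Every link lies in its own star window (`hself`). -/
theorem self_mem_starWin (c : Edge d L) : c ∈ starWin c := mem_starWin.2 (fst_mem_linkEnds c)

/-- **At most `2d` star windows contain a given link** (`N⋆ = 2d`; `= 8` for `d = 4`): the windows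
containing `x` are those of the links based at one of the two endpoints of `x`. -/
theorem card_filter_mem_starWin_le (x : Edge d L) :
    (univ.filter fun c => x ∈ starWin c).card ≤ 2 * d := by
  classical
  have hsub : (univ.filter fun c => x ∈ starWin c) ⊆
      (univ.image fun μ : Fin d => ((x.1, μ) : Edge d L)) ∪
        univ.image fun μ : Fin d => ((x.1.shift x.2, μ) : Edge d L) := by
    intro c hc
    have h := mem_starWin.1 (mem_filter.1 hc).2
    rw [mem_linkEnds] at h
    rw [mem_union, mem_image, mem_image]
    rcases h with h | h
    · exact Or.inl ⟨c.2, mem_univ _, by rw [← h]⟩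
    · exact Or.inr ⟨c.2, mem_univ _, by rw [← h]⟩
  calc (univ.filter fun c => x ∈ starWin c).card
      ≤ ((univ.image fun μ : Fin d => ((x.1, μ) : Edge d L)) ∪
          univ.image fun μ : Fin d => ((x.1.shift x.2, μ) : Edge d L)).card := card_le_card hsub
    _ ≤ (univ.image fun μ : Fin d => ((x.1, μ) : Edge d L)).card +
          (univ.image fun μ : Fin d => ((x.1.shift x.2, μ) : Edge d L)).card :=
        card_union_le _ _
    _ ≤ d + d := add_le_add (card_image_le.trans (by simp)) (card_image_le.trans (by simp))
    _ = 2 * d := by ring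

/-- **(H2) for the star windows from a uniform per-star bound.** If the array of the window of `c`
is `K c.1` (it depends on `c` only through the star's vertex) and `Σ_y K s y x ≤ ρ` for every star
vertex `s` of every link `x ∈ vertexStar s`, then `IsDSReceivedSum starWin (fun c => K c.1) ρ`
(both sides of (H2) carry the factor `#{c : x ∈ starWin c}`). -/
theorem isDSReceivedSum_starWin {K : Site d L → Edge d L → Edge d L → ℝ} {ρ : ℝ}
    (hsum : ∀ (s : Site d L) (x : Edge d L), x ∈ vertexStar s → ∑ y, K s y x ≤ ρ) :
    IsDSReceivedSum (starWin (d := d) (L := L)) (fun c => K c.1) ρ := by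
  intro x
  calc ∑ c ∈ univ.filter (fun c => x ∈ starWin c), ∑ y, K c.1 y x
      ≤ ∑ _c ∈ univ.filter (fun c => x ∈ starWin c), ρ :=
        sum_le_sum fun c hc => hsum c.1 x (mem_filter.1 hc).2
    _ = ρ * (univ.filter fun c => x ∈ starWin c).card := by
        rw [sum_const, nsmul_eq_mul, mul_comm]

end Stars

/-! ### Corner geometry: endpoints of links on a common plaquette are at sup-distance `≤ 1` -/

section Corners

/-- The base point of an edge of the plaquette `q` has offset `0` from `q.1` in the edge's own
direction. -/
theorem apply_dir_sub_eq_zero_of_mem_plaqEdgesT {q : Plaquette d L} {e : Edge d L}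
    (he : e ∈ plaqEdgesT q) : e.1 e.2 - q.1 e.2 = 0 := by
  have hne : q.2.1.1 ≠ q.2.1.2 := q.2.2.ne
  simp only [plaqEdgesT, mem_insert, mem_singleton] at he
  rcases he with rfl | rfl | rfl | rfl
  · simp
  · simp [Literature.MathematicalPhysics.QuantumFieldTheory.Site.shift, hne.symm]
  · simp [Literature.MathematicalPhysics.QuantumFieldTheory.Site.shift, hne]
  · simp

/-- Coordinates of an endpoint of an edge of `q` exceed those of `q.1` by `0` or `1` (endpoints are
corners of the plaquette). -/
theorem linkEnds_sub_eq_zero_or_one {q : Plaquette d L} {e : Edge d L} (he : e ∈ plaqEdgesT q)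
    {v : Site d L} (hv : v ∈ linkEnds e) (k : Fin d) : v k - q.1 k = 0 ∨ v k - q.1 k = 1 := by
  rcases mem_linkEnds.1 hv with rfl | rfl
  · exact apply_sub_eq_zero_or_one_of_mem_plaqEdgesT he k
  · by_cases hk : k = e.2
    · subst hk
      right
      have h0 := apply_dir_sub_eq_zero_of_mem_plaqEdgesT he
      simp only [Literature.MathematicalPhysics.QuantumFieldTheory.Site.shift, Pi.add_apply, Pi.single_eq_same]
      linear_combination h0
    · have h := apply_sub_eq_zero_or_one_of_mem_plaqEdgesT he k
      simp only [Literature.MathematicalPhysics.QuantumFieldTheory.Site.shift, Pi.add_apply, Pi.single_apply, if_neg hk,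
        add_zero]
      exact h

/-- Two sites whose coordinates both exceed those of a third by `0` or `1` are at periodic
sup-distance `≤ 1`. -/
theorem torusNorm_sub_le_one_of_offsets {a b c : Site d L}
    (ha : ∀ k, a k - c k = 0 ∨ a k - c k = 1) (hb : ∀ k, b k - c k = 0 ∨ b k - c k = 1) :
    torusNorm (a - b) ≤ 1 := by
  refine Finset.sup_le fun k _ => ?_
  have h0 : ((0 : ZMod L).valMinAbs).natAbs ≤ 1 := by simp
  have hn : ((-1 : ZMod L).valMinAbs).natAbs ≤ 1 := by
    rw [ZMod.natAbs_valMinAbs_neg]; exact natAbs_valMinAbs_one_le_one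
  show ((a - b) k).valMinAbs.natAbs ≤ 1
  rw [Pi.sub_apply, ← sub_sub_sub_cancel_right (a k) (b k) (c k)]
  rcases ha k with h1 | h1 <;> rcases hb k with h2 | h2 <;> rw [h1, h2]
  · rwa [sub_zero]
  · rwa [zero_sub]
  · rw [sub_zero]; exact natAbs_valMinAbs_one_le_one
  · rwa [sub_self]

/-- **Endpoints of two links on a common plaquette are at periodic sup-distance `≤ 1`.** A star
array supported on the boundary links of the star's vertex plaquettes therefore satisfies the
support condition `hKloc` of the doors below. -/
theorem torusNorm_linkEnds_sub_le_one {q : Plaquette d L} {x y : Edge d L}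
    (hx : x ∈ plaqEdgesT q) (hy : y ∈ plaqEdgesT q) {v w : Site d L} (hv : v ∈ linkEnds x)
    (hw : w ∈ linkEnds y) : torusNorm (v - w) ≤ 1 :=
  torusNorm_sub_le_one_of_offsets (linkEnds_sub_eq_zero_or_one hx hv)
    (linkEnds_sub_eq_zero_or_one hy hw)

end Corners

/-! ### The star certificate and its door -/

section Door

variable [NeZero L]

omit [NeZero L] in
/-- **The distance-to-endpoints profile.** For link sets `Δf, Δg` (`Δg` nonempty) whose endpoints
are at periodic sup-distance `≥ L₀`, `D(s) = min_{z ∈ Δg, w ∈ ends z} ‖s − w‖_{∞,L}` vanishes on the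
endpoints of `Δg`, is non-expanding (`D s ≤ D w + 1` when `‖s − w‖_{∞,L} ≤ 1`) and is `≥ L₀` on
the endpoints of `Δf` (Föllmer 1988 Ch. I (2.23); cf. the tree's single-link `exists_linkProfile`). -/
theorem exists_starProfile (Δf Δg : Finset (Edge d L)) (L₀ : ℕ)
    (hL₀ : ∀ x ∈ Δf, ∀ z ∈ Δg, ∀ v ∈ linkEnds x, ∀ w ∈ linkEnds z, L₀ ≤ torusNorm (v - w))
    (hne : Δg.Nonempty) :
    ∃ D : Site d L → ℕ, (∀ z ∈ Δg, ∀ w ∈ linkEnds z, D w = 0) ∧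
      (∀ s w, torusNorm (s - w) ≤ 1 → D s ≤ D w + 1) ∧
      (∀ x ∈ Δf, ∀ v ∈ linkEnds x, L₀ ≤ D v) := by
  refine ⟨fun s => Δg.inf' hne fun z => (linkEnds z).inf' (linkEnds_nonempty z)
    fun w => torusNorm (s - w), ?_, ?_, ?_⟩
  · intro z hz w hw
    dsimp only
    apply Nat.eq_zero_of_le_zero
    calc Δg.inf' hne (fun z' => (linkEnds z').inf' (linkEnds_nonempty z')
            fun w' => torusNorm (w - w'))
        ≤ (linkEnds z).inf' (linkEnds_nonempty z) fun w' => torusNorm (w - w') :=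
          Finset.inf'_le _ hz
      _ ≤ torusNorm (w - w) := Finset.inf'_le _ hw
      _ = 0 := by rw [sub_self, torusNorm_zero]
  · intro s w hsw
    dsimp only
    obtain ⟨z, hz, hzeq⟩ := Finset.exists_mem_eq_inf' hne fun z =>
      (linkEnds z).inf' (linkEnds_nonempty z) fun w' => torusNorm (w - w')
    obtain ⟨w', hw', hweq⟩ :=
      Finset.exists_mem_eq_inf' (linkEnds_nonempty z) fun w' => torusNorm (w - w')
    rw [hzeq, hweq]
    calc Δg.inf' hne (fun z => (linkEnds z).inf' (linkEnds_nonempty z)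
            fun w' => torusNorm (s - w'))
        ≤ (linkEnds z).inf' (linkEnds_nonempty z) fun w' => torusNorm (s - w') :=
          Finset.inf'_le _ hz
      _ ≤ torusNorm (s - w') := Finset.inf'_le _ hw'
      _ ≤ torusNorm (s - w) + torusNorm (w - w') := torusNorm_sub_le _ _ _
      _ ≤ 1 + torusNorm (w - w') := Nat.add_le_add_right hsw _
      _ = torusNorm (w - w') + 1 := by ring
  · intro x hx v hv
    dsimp only
    refine Finset.le_inf' _ _ fun z hz => Finset.le_inf' _ _ fun w hw => ?_
    exact hL₀ x hx z hz v hv w hw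

variable {G : Type*} [Group G] [TopologicalSpace G] [IsTopologicalGroup G] [CompactSpace G]
  [MeasurableSpace G] [BorelSpace G]

/-- **The star certificate.** For a plaquette weight `v`, a group weight `r ≤ R`, and a
vertex-indexed array `K(s; y → x) ≥ 0` satisfying (H1) `IsLinkWindowContraction` for the STAR
windows (`starWin c = vertexStar c.1`, array `K c.1`) and the per-star received sum
`Σ_y K(s; y → x) ≤ ρ < 1` for `x ∈ vertexStar s`: the `Certificate` of `DSWindowCertificate.lean`
with `N⋆ = 2d` (`Certificate.ofLinkWindows`). The array is an INPUT (for `SU(2)`, `d = 4`: the cell's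
Lemma S, not proved here). -/
def starCertificate (v : G → ℝ) (r : G → G → ℝ) (R : ℝ) (hR : 0 ≤ R) (hrR : ∀ a b, r a b ≤ R)
    (K : Site d L → Edge d L → Edge d L → ℝ) (hK : ∀ s y x, 0 ≤ K s y x)
    (hcontract : IsLinkWindowContraction v r (starWin (d := d) (L := L)) fun c => K c.1)
    (ρ : ℝ) (hρ0 : 0 ≤ ρ) (hρ1 : ρ < 1)
    (hsum : ∀ (s : Site d L) (x : Edge d L), x ∈ vertexStar s → ∑ y, K s y x ≤ ρ) :
    Certificate (torusWeightSpec (d := d) (L := L) v) (id : Edge d L → Edge d L) :=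
  Certificate.ofLinkWindows v r R hR hrR starWin self_mem_starWin (2 * d)
    card_filter_mem_starWin_le (fun c => K c.1) (fun c y x => hK c.1 y x) hcontract ρ hρ0 hρ1
    (isDSReceivedSum_starWin hsum)

variable [SecondCountableTopology G] [MeasurableSingletonClass G]

/-- **THE STAR DOOR, kernel side (any compact group, any positive continuous plaquette weight, any
torus side).** Let `K(s; y → x) ≥ 0` be a vertex-indexed influence array supported on boundary links
`y` whose endpoints are within periodic sup-distance `1` of `s` (`hKloc`; automatic on the vertex
plaquettes at `s` by `torusNorm_linkEnds_sub_le_one`), satisfying the window contraction (H1) for the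
star windows over the whole exterior field space (`hcontract`) and the per-star received sum
`Σ_y K(s; y → x) ≤ ρ` for `x ∈ vertexStar s`, `ρ < 1` (`hsum`). Then for the plaquette-weight
measure `Z⁻¹ ∏_q v(U_q) ∏ dU` and admissible link observables `f, g` on `Δf, Δg` whose endpoints
are `≥ L₀` apart in the periodic sup-distance:
`|cov(f, g)| ≤ 4 R² exp(−(1 − ρ)² L₀ / (2(2ρ·2d + 1))) (Σ δf)(Σ δg)` — the tree theorem
`DobrushinShlosman.abs_covariance_le` with `N⋆ = 2d` and the distance-to-endpoints profile
`ℓ x = min_{v ∈ ends x} D v`. -/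
theorem star_abs_covariance_le {v : G → ℝ} (hv : Continuous v) (hv0 : ∀ g, 0 < v g)
    {r : G → G → ℝ} {R : ℝ} (hR : 0 ≤ R) (hrR : ∀ a b, r a b ≤ R)
    {K : Site d L → Edge d L → Edge d L → ℝ} (hK : ∀ s y x, 0 ≤ K s y x)
    (hKloc : ∀ s y x, K s y x ≠ 0 → ∀ w ∈ linkEnds y, torusNorm (s - w) ≤ 1)
    (hcontract : IsLinkWindowContraction v r (starWin (d := d) (L := L)) fun c => K c.1)
    {ρ : ℝ} (hρ0 : 0 ≤ ρ) (hρ1 : ρ < 1)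
    (hsum : ∀ (s : Site d L) (x : Edge d L), x ∈ vertexStar s → ∑ y, K s y x ≤ ρ)
    {f g : GaugeConfig d L G → ℝ} {Δf Δg : Finset (Edge d L)} {δf δg : Edge d L → ℝ}
    (hf : LinkObs r f Δf δf) (hg : LinkObs r g Δg δg) (L₀ : ℕ)
    (hL₀ : ∀ x ∈ Δf, ∀ z ∈ Δg, ∀ a ∈ linkEnds x, ∀ w ∈ linkEnds z, L₀ ≤ torusNorm (a - w)) :
    |cov[f, g; groupHeatKernelMeasure (d := d) (L := L) (fun _ : ℝ => v) 0]| ≤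
      4 * R ^ 2 * Real.exp (-((1 - ρ) ^ 2 / (2 * (2 * ρ * (2 * d : ℕ) + 1)) * L₀)) *
        (∑ x ∈ Δf, δf x) * ∑ y ∈ Δg, δg y := by
  obtain ⟨C, hC⟩ : ∃ C : Certificate (torusWeightSpec (d := d) (L := L) v) (id : Edge d L → Edge d L),
      C = starCertificate v r R hR hrR K hK hcontract ρ hρ0 hρ1 hsum := ⟨_, rfl⟩
  have hw : C.w = linkWeight r := by rw [hC]; rfl
  have hRC : C.R = R := by rw [hC]; rfl
  have hrate : C.rate = (1 - ρ) ^ 2 / (2 * (2 * ρ * (2 * d : ℕ) + 1)) := by rw [hC]; rfl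
  have hwin : ∀ c x, x ∈ C.win c ↔ c.1 ∈ linkEnds x := by
    intro c x; rw [hC]; exact mem_starWin
  have hkC : ∀ c y x, C.k c y x ≠ 0 → ∀ w ∈ linkEnds y, torusNorm (c.1 - w) ≤ 1 := by
    intro c y x hk
    rw [hC] at hk
    exact hKloc _ _ _ hk
  have key : ∀ ℓ : Edge d L → ℕ, C.Profile Δf Δg ℓ L₀ →
      |cov[f, g; groupHeatKernelMeasure (d := d) (L := L) (fun _ : ℝ => v) 0]| ≤
        4 * R ^ 2 * Real.exp (-((1 - ρ) ^ 2 / (2 * (2 * ρ * (2 * d : ℕ) + 1)) * L₀)) *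
          (∑ x ∈ Δf, δf x) * ∑ y ∈ Δg, δg y := by
    intro ℓ hℓ
    have h := plaquetteWeight_abs_covariance_le hv hv0 C (hf.obs C hw) (hg.obs C hw) hℓ
    rw [hRC, hrate] at h
    exact h
  rcases Δg.eq_empty_or_nonempty with hΔg | hne
  · refine key (fun _ => L₀) ⟨fun x hx c hxc z hzc hzg => ?_, fun c x y _ _ => Nat.le_succ _,
      fun x _ => le_rfl⟩
    rw [hΔg] at hzg
    exact absurd hzg (Finset.notMem_empty z)
  · obtain ⟨D, hD0, hD1, hDL⟩ := exists_starProfile Δf Δg L₀ hL₀ hne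
    refine key (fun x => (linkEnds x).inf' (linkEnds_nonempty x) D) ⟨?_, ?_, ?_⟩
    · -- windows around links of positive profile avoid `Δg`
      intro x hx c hxc z hzc hzg
      have h1 : c.1 ∈ linkEnds x := (hwin c x).1 hxc
      have h2 : c.1 ∈ linkEnds z := (hwin c z).1 hzc
      apply hx
      apply Nat.eq_zero_of_le_zero
      calc (linkEnds x).inf' (linkEnds_nonempty x) D ≤ D c.1 := Finset.inf'_le _ h1
        _ = 0 := hD0 z hzg c.1 h2
    · -- one step of influence lowers the profile by at most one
      intro c x y hxc hk
      have h1 : c.1 ∈ linkEnds x := (hwin c x).1 hxc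
      obtain ⟨w, hw, hweq⟩ := Finset.exists_mem_eq_inf' (linkEnds_nonempty y) D
      show (linkEnds x).inf' (linkEnds_nonempty x) D ≤ (linkEnds y).inf' (linkEnds_nonempty y) D + 1
      rw [hweq]
      calc (linkEnds x).inf' (linkEnds_nonempty x) D ≤ D c.1 := Finset.inf'_le _ h1
        _ ≤ D w + 1 := hD1 _ _ (hkC c y x hk w hw)
    · -- the profile is `≥ L₀` on `Δf`
      intro x hx
      exact Finset.le_inf' _ _ fun a ha => hDL x hx a ha

end Door

/-! ### `SU(2)`, `d = 4`: the named hypothesis schema the cell's Lemma S must deliver, and the door -/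

section SU2

variable {L : ℕ} [NeZero L]

variable (L) in
/-- **The star window bound at Wilson coupling `β_W` with received sum `≤ ρ`** — the HYPOTHESIS
SCHEMA the cell's Lemma S (STAR-DOOR.md §3–4 / STAR-PROOF.md, class A + certified tables) has to
deliver on the torus `(ℤ/L)^4`, for the group weight `r` on `SU(2)`: there is a vertex-indexed array
`K(s; y → x) ≥ 0`, supported on boundary links `y` with both endpoints within periodic sup-distance
`1` of `s`, satisfying the window contraction (H1) `IsLinkWindowContraction` for the STAR windows
(`starWin c = vertexStar c.1`) of the `SU(2)` Wilson torus weight specification at tree coupling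
`β_W/2` over the WHOLE exterior field space, with per-star received sum `Σ_y K(s; y → x) ≤ ρ` for
every `x ∈ vertexStar s`. (Cell: `ρ = starR β_W τ₅ κ_q Λ₃`, float `R(1/4) ≈ 0.81`, `R(11/40) ≈ 0.97`.)
A `Prop`; never asserted here. -/
def StarWindowBound (βW ρ : ℝ)
    (r : Matrix.specialUnitaryGroup (Fin 2) ℂ → Matrix.specialUnitaryGroup (Fin 2) ℂ → ℝ) : Prop :=
  ∃ K : Site 4 L → Edge 4 L → Edge 4 L → ℝ,
    (∀ s y x, 0 ≤ K s y x) ∧ (∀ s y x, K s y x ≠ 0 → ∀ w ∈ linkEnds y, torusNorm (s - w) ≤ 1) ∧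
    IsLinkWindowContraction (d := 4) (L := L) (wilsonPlaqWeight 2 (βW / 2)) r starWin
      (fun c => K c.1) ∧
    ∀ (s : Site 4 L) (x : Edge 4 L), x ∈ vertexStar s → ∑ y, K s y x ≤ ρ

/-- **THE STAR DOOR for `SU(2)` lattice Yang–Mills on `(ℤ/L)^4`** (any torus side; Wilson coupling
`β_W`, tree coupling `β_W/2`, plaquette weight `exp(−(β_W/2)(2 − Re tr U_q))`): the star window bound
with received sum `ρ < 1` for a group weight `r ≤ R` gives, for every pair of admissible link
observables whose endpoints are `≥ L₀` apart in the periodic sup-distance,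
`|cov(f, g)| ≤ 4 R² exp(−(1 − ρ)² L₀ / (2(16ρ + 1))) (Σ δf)(Σ δg)` under the torus Wilson measure —
constants independent of `L`. Clustering currency at that `β_W` (cell target rows: `β_W = 1/4`,
then `11/40`, once Lemma S is audited and `starR` certified); nothing about the continuum or the
mass gap; the hypothesis `StarWindowBound` is NOT proved here. -/
theorem su2Star_abs_covariance_le (βW : ℝ)
    {r : Matrix.specialUnitaryGroup (Fin 2) ℂ → Matrix.specialUnitaryGroup (Fin 2) ℂ → ℝ} {R : ℝ}
    (hR : 0 ≤ R) (hrR : ∀ a b, r a b ≤ R) {ρ : ℝ} (hρ0 : 0 ≤ ρ) (hρ1 : ρ < 1)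
    (hS : StarWindowBound L βW ρ r)
    {f g : GaugeConfig 4 L (Matrix.specialUnitaryGroup (Fin 2) ℂ) → ℝ} {Δf Δg : Finset (Edge 4 L)}
    {δf δg : Edge 4 L → ℝ} (hf : LinkObs r f Δf δf) (hg : LinkObs r g Δg δg) (L₀ : ℕ)
    (hL₀ : ∀ x ∈ Δf, ∀ z ∈ Δg, ∀ a ∈ linkEnds x, ∀ w ∈ linkEnds z, L₀ ≤ torusNorm (a - w)) :
    |cov[f, g; wilsonMeasure (d := 4) (L := L) (fundamentalRep (Fin 2)) (βW / 2)]| ≤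
      4 * R ^ 2 * Real.exp (-((1 - ρ) ^ 2 / (2 * (16 * ρ + 1)) * L₀)) *
        (∑ x ∈ Δf, δf x) * ∑ y ∈ Δg, δg y := by
  haveI : SecondCountableTopology (Matrix (Fin 2) (Fin 2) ℂ) :=
    inferInstanceAs (SecondCountableTopology (Fin 2 → Fin 2 → ℂ))
  haveI : SecondCountableTopology (Matrix.specialUnitaryGroup (Fin 2) ℂ) :=
    Topology.IsEmbedding.subtypeVal.secondCountableTopology
  obtain ⟨K, hK, hKloc, hcontract, hsum⟩ := hS
  rw [wilsonMeasure_eq_groupHeatKernelMeasure]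
  have h := star_abs_covariance_le (continuous_wilsonPlaqWeight (βW / 2))
    (wilsonPlaqWeight_pos (βW / 2)) hR hrR hK hKloc hcontract hρ0 hρ1 hsum hf hg L₀ hL₀
  have e : (2 * ρ * ((2 * 4 : ℕ) : ℝ) + 1) = 16 * ρ + 1 := by push_cast; ring
  rw [e] at h
  exact h

end SU2
end Summit.Ventures.YMGap.DSWindow
end
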